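import Literature.Probability.LatticeModels.SubharmonicEnergy
import HarnessLib

/-!
# The `L¹` gradient bound for a bounded subharmonic function squeezed above a superharmonic one

Topic `Literature/Probability/LatticeModels`; continuation of `SubharmonicEnergy.lean` (items
P3–P4 / core of G2 of the road in `Sweep1Proofs.lean`, module docstring §2b), isolating the main
estimate `sum_abs_sub_le_of_subharmonic_le_superharmonic`: if `s` is subharmonic and `w`
superharmonic on a box of side `4m` (and `s` a bit beyond), `0 ≤ s ≤ 1` and `w ≤ s ≤ w + 1`,
then `∑_{x ∈ ball m} ∑_k |s(x + e_k) - s(x)| ≤ C m`. Proof: the harmonic extension `HH` of the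
side values of `s` satisfies `s ≤ HH ≤ w + 1 ≤ s + 1` (maximum principle), so `u = HH - s ∈ [0, 1]`
has Dirichlet energy `∑ (∇u)² = 2 ∑ u Δs ≤ 160` (`sum_sq_sub_eq_neg_two_mul_sum`,
`sum_latticeLaplacian_le`); Cauchy–Schwarz gives `∑ |∇u| = O(m)` and the interior gradient
estimate of `BoxDirichlet.lean` gives `∑ |∇HH| = O(m)`. Applied to the FK primitive
(`Hb` subharmonic, `Hw` superharmonic, `Hw ≤ Hb ≤ Hw + 1`, `0 ≤ H ≤ 1`) this is the `O(1/δ)` bound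
on `∑ |∇H|` over a compact, i.e. on `∑ |F|²` — Smirnov 2010, Lemma 5.3 — with no smallness of
the fluxes needed. Everything is proved.

## References

* S. Smirnov, Ann. of Math. 172 (2010) 1435–1467, Lemma 5.3 — bib key `Smirnov2010`.
-/

noncomputable section

namespace Literature.Probability.LatticeModels

open Finset Real

/-! ### The sandwich between a subharmonic and a superharmonic function, and the `L¹` gradient bound -/

section Sandwich

variable {a : Site 2} {m : ℕ}

/-- The centre of the box of side `4m` with lower-left corner `a`. [folklore] -/
def boxCentre (a : Site 2) (m : ℕ) : Site 2 := ![a 0 + 2 * m, a 1 + 2 * m]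

/-- The interior of the box of side `4m` at `a` is the lattice ball of radius `2m - 1` about its
centre. [folklore] -/
theorem mem_boxInterior_iff_mem_latticeBall {x : Site 2} :
    x ∈ boxInterior a (4 * m) ↔ x ∈ latticeBall (boxCentre a m) (2 * m - 1) := by
  rw [mem_latticeBall]
  simp only [boxInterior, Set.mem_setOf_eq, boxCentre, Fin.forall_fin_two, Matrix.cons_val_zero,
    Matrix.cons_val_one]
  push_cast
  omega

/-- The middle region of the box of side `4m` at `a` is the lattice ball of radius `m` about its
centre. [folklore] -/
theorem mem_boxMiddle_iff_mem_latticeBall {x : Site 2} :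
    x ∈ boxMiddle a (4 * m) ↔ x ∈ latticeBall (boxCentre a m) m := by
  rw [mem_latticeBall]
  simp only [boxMiddle, Set.mem_setOf_eq, boxCentre, Fin.forall_fin_two, Matrix.cons_val_zero,
    Matrix.cons_val_one]
  push_cast
  omega

/-- The constant of the `L¹` gradient bound. [folklore] -/
def energyGradConst : ℝ := 36 * topGradConst + 78

/-- `C > 0`. [folklore] -/
theorem energyGradConst_pos : 0 < energyGradConst := by
  unfold energyGradConst; have := topGradConst_pos; positivity

/-- **`L¹` gradient bound for a bounded subharmonic function squeezed above a superharmonic one.**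
Let `s` be subharmonic on the ball of radius `4m` about the centre `c` of the box of side `4m` at
`a`, with `0 ≤ s ≤ 1` on the ball of radius `4m + 1`, and let `w` be superharmonic on the box
interior with `w ≤ s ≤ w + 1` on the ball of radius `2m` (`m ≥ 4`). Then
`∑_{x ∈ ball(c, m)} ∑_k |s(x + e_k) - s(x)| ≤ C m`. Proof: with `HH` the harmonic extension of the
side values of `s` to the box interior, `s ≤ HH ≤ w + 1 ≤ s + 1` (maximum principle), so
`u = HH - s ∈ [0, 1]` vanishes off the interior and has Dirichlet energy
`∑ (∇u)² = 2 ∑ u Δs ≤ 2 ∑ Δs ≤ 160` (`sum_sq_sub_eq_neg_two_mul_sum`, `sum_latticeLaplacian_le`);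
Cauchy–Schwarz bounds `∑ |∇u|` by `O(m)`, and `∑ |∇HH| = O(m)` by the interior gradient estimate
`harmonic_box_gradient_le`. This is the discrete core of the compactness Lemma 5.3 of Smirnov 2010
(there via Green's function bounds, Lemma B.4). [cite: Smirnov2010, Lemma 5.3] -/
theorem sum_abs_sub_le_of_subharmonic_le_superharmonic (hm : 4 ≤ m) {s w : Site 2 → ℝ}
    (hsub : IsLatticeSubharmonicOn s (latticeBall (boxCentre a m) (2 * (2 * m)) : Set (Site 2)))
    (hs : ∀ x ∈ latticeBall (boxCentre a m) (2 * (2 * m) + 1), 0 ≤ s x ∧ s x ≤ 1)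
    (hsup : IsLatticeSuperharmonicOn w (boxInterior a (4 * m)))
    (hws : ∀ x ∈ latticeBall (boxCentre a m) (2 * m), w x ≤ s x ∧ s x ≤ w x + 1) :
    ∑ x ∈ latticeBall (boxCentre a m) m, ∑ k : Fin 4, |s (x + cornerUnit k) - s x| ≤ energyGradConst * m := by
  set c := boxCentre a m with hc
  set N := 4 * m with hN
  have hN16 : 16 ≤ N := by omega
  set S := boxInterior a N with hS
  have hSfin : S.Finite := boxInterior_finite a N
  -- the harmonic extension of `s` from outside `S`
  obtain ⟨HH, hHH, hHHoff⟩ := exists_isLatticeHarmonicOn_eq_off hSfin s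
  -- membership bookkeeping
  have hS_ball : ∀ x ∈ S, x ∈ latticeBall c (2 * m - 1) := fun x hx =>
    (mem_boxInterior_iff_mem_latticeBall (a := a) (m := m)).1 hx
  have hbd_ball : ∀ x ∈ latticeOuterBoundary S, x ∈ latticeBall c (2 * m) := by
    rintro x ⟨-, v, hv, k, rfl⟩
    have := add_cornerUnit_mem_latticeBall (hS_ball v hv) k
    have e : (2 * m - 1 : ℤ) + 1 = 2 * m := by ring
    rwa [e] at this
  have hball_sub : ∀ {R R' : ℤ}, R ≤ R' → ∀ x ∈ latticeBall c R, x ∈ latticeBall c R' :=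
    fun h x hx => latticeBall_subset h hx
  -- (1) `s ≤ HH` on `S`
  have hsubS : IsLatticeSubharmonicOn s S := fun y hy => hsub y (hball_sub (by omega) y (hS_ball y hy))
  have h1 : ∀ x ∈ S, s x ≤ HH x := by
    intro x hx
    have := le_of_sub_super_of_boundary hSfin hsubS hHH.superharmonicOn (c := 0)
      (fun w' hw' => by rw [hHHoff w' hw'.1, add_zero]) x hx
    simpa using this
  -- (2) `HH ≤ w + 1` on `S`
  have h2 : ∀ x ∈ S, HH x ≤ w x + 1 := by
    intro x hx
    exact le_of_sub_super_of_boundary hSfin hHH.subharmonicOn hsup (c := 1)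
      (fun w' hw' => by rw [hHHoff w' hw'.1]; exact (hws w' (hbd_ball w' hw')).2) x hx
  -- (3) `0 ≤ u ≤ 1` where `u = HH - s`, and `u = 0` off `S`
  set u : Site 2 → ℝ := fun x => HH x - s x with hu
  have hu0 : ∀ x, x ∉ S → u x = 0 := fun x hx => by simp [hu, hHHoff x hx]
  have hu01 : ∀ x, 0 ≤ u x ∧ u x ≤ 1 := by
    intro x
    by_cases hx : x ∈ S
    · have := h1 x hx; have := h2 x hx; have := (hws x (hball_sub (by omega) x (hS_ball x hx))).1
      exact ⟨by simp [hu]; linarith, by simp [hu]; linarith⟩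
    · rw [hu0 x hx]; exact ⟨le_rfl, zero_le_one⟩
  -- (4) energy bound: `∑_{ball 2m} ∑_k (∇u)² ≤ 160`
  set B := latticeBall c (2 * m) with hB
  have hsuppu : ∀ x, u x ≠ 0 → x ∈ B ∧ ∀ k : Fin 4, x + cornerUnit k ∈ B := by
    intro x hx
    have hxS : x ∈ S := by by_contra h; exact hx (hu0 x h)
    refine ⟨hball_sub (by omega) x (hS_ball x hxS), fun k => ?_⟩
    have := add_cornerUnit_mem_latticeBall (hS_ball x hxS) k
    have e : (2 * m - 1 : ℤ) + 1 = 2 * m := by ring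
    rwa [e] at this
  have henergy : ∑ x ∈ B, ∑ k : Fin 4, (u (x + cornerUnit k) - u x) ^ 2 ≤ 160 := by
    rw [sum_sq_sub_eq_neg_two_mul_sum hsuppu]
    -- `-2 ∑ u Δu = 2 ∑_S u Δs ≤ 2 ∑_{ball 2m} Δs ≤ 160`
    have hterm : ∀ x ∈ B, -(u x * latticeLaplacian u x) ≤ latticeLaplacian s x := by
      intro x hxB
      by_cases hxS : x ∈ S
      · have hΔ : latticeLaplacian u x = -latticeLaplacian s x := by
          have e : u = HH - s := rfl
          rw [e, latticeLaplacian_sub, hHH x hxS]; ring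
        rw [hΔ]
        have hs0 : 0 ≤ latticeLaplacian s x := hsub x (hball_sub (by omega) x hxB)
        nlinarith [(hu01 x).1, (hu01 x).2]
      · rw [hu0 x hxS]; simp only [zero_mul, neg_zero]
        exact hsub x (hball_sub (by omega) x hxB)
    have hm0 : 0 < 2 * m := by omega
    calc -2 * ∑ x ∈ B, u x * latticeLaplacian u x = 2 * ∑ x ∈ B, -(u x * latticeLaplacian u x) := by
          rw [Finset.sum_neg_distrib]; ring
      _ ≤ 2 * ∑ x ∈ B, latticeLaplacian s x := by
          refine mul_le_mul_of_nonneg_left (Finset.sum_le_sum hterm) (by norm_num)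
      _ ≤ 2 * 80 := by
          refine mul_le_mul_of_nonneg_left ?_ (by norm_num)
          exact sum_latticeLaplacian_le hm0 hsub hs
      _ = 160 := by norm_num
  -- (5) gradient of `HH` on the middle region
  have hKpos := topGradConst_pos
  have hNr : (0 : ℝ) < N := by rw [hN]; exact_mod_cast (show 0 < 4 * m by omega)
  have hgradHH : ∀ x ∈ latticeBall c m, ∀ k : Fin 4, |HH (x + cornerUnit k) - HH x| ≤ 4 * topGradConst * 1 / N := by
    intro x hx k
    have hxM : x ∈ boxMiddle a N := (mem_boxMiddle_iff_mem_latticeBall (a := a) (m := m)).2 hx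
    refine harmonic_box_gradient_le a N hN16 hHH zero_le_one (fun i hi hiN => ?_) hxM k
    -- on the four open sides `HH = s ∈ [0, 1]`
    have side : ∀ y : Site 2, y ∉ S → y ∈ latticeBall c (2 * (2 * m) + 1) → |HH y| ≤ 1 := by
      intro y hy hy'
      rw [hHHoff y hy, abs_le]
      obtain ⟨h0, h1⟩ := hs y hy'
      exact ⟨by linarith, h1⟩
    have hiN' : (i : ℤ) < N := by exact_mod_cast hiN
    have hi' : (0 : ℤ) < i := by exact_mod_cast hi
    have hnotS : ∀ y : Site 2, (y 0 = a 0 ∨ y 0 = a 0 + N ∨ y 1 = a 1 ∨ y 1 = a 1 + N) → y ∉ S := by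
      rintro y hy ⟨k0, k0', k1, k1'⟩; omega
    have hinball : ∀ y : Site 2, a 0 ≤ y 0 → y 0 ≤ a 0 + N → a 1 ≤ y 1 → y 1 ≤ a 1 + N →
        y ∈ latticeBall c (2 * (2 * m) + 1) := by
      intro y k0 k0' k1 k1'
      rw [mem_latticeBall]
      intro j; fin_cases j <;> simp [hc, boxCentre] <;> omega
    refine ⟨side _ (hnotS _ ?_) (hinball _ ?_ ?_ ?_ ?_), side _ (hnotS _ ?_) (hinball _ ?_ ?_ ?_ ?_),
      side _ (hnotS _ ?_) (hinball _ ?_ ?_ ?_ ?_), side _ (hnotS _ ?_) (hinball _ ?_ ?_ ?_ ?_)⟩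
    all_goals simp
    all_goals omega
  -- (6) assemble
  have hcard : ((latticeBall c m).card : ℝ) = (2 * m + 1) ^ 2 := by
    rw [latticeBall, Fintype.card_piFinset, Fin.prod_univ_two, Int.card_Icc, Int.card_Icc]
    have e1 : (c 0 + (m : ℤ) + 1 - (c 0 - m)).toNat = 2 * m + 1 := by omega
    have e2 : (c 1 + (m : ℤ) + 1 - (c 1 - m)).toNat = 2 * m + 1 := by omega
    rw [e1, e2]
    push_cast; ring
  have hmr : (1 : ℝ) ≤ m := by exact_mod_cast (show 1 ≤ m by omega)
  -- split `∇s = ∇HH - ∇u`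
  have hsplit : ∀ x ∈ latticeBall c m, ∀ k : Fin 4,
      |s (x + cornerUnit k) - s x| ≤ |HH (x + cornerUnit k) - HH x| + |u (x + cornerUnit k) - u x| := by
    intro x _ k
    have e : s (x + cornerUnit k) - s x = (HH (x + cornerUnit k) - HH x) - (u (x + cornerUnit k) - u x) := by
      simp [hu]; ring
    rw [e]; exact abs_sub _ _
  -- the harmonic part
  have hpartHH : ∑ x ∈ latticeBall c m, ∑ k : Fin 4, |HH (x + cornerUnit k) - HH x| ≤ 36 * topGradConst * m := by
    calc ∑ x ∈ latticeBall c m, ∑ k : Fin 4, |HH (x + cornerUnit k) - HH x|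
        ≤ ∑ x ∈ latticeBall c m, ∑ k : Fin 4, 4 * topGradConst * 1 / N :=
          Finset.sum_le_sum fun x hx => Finset.sum_le_sum fun k _ => hgradHH x hx k
      _ = (2 * m + 1) ^ 2 * (4 * (4 * topGradConst * 1 / N)) := by
          simp only [Finset.sum_const, Finset.card_univ, Fintype.card_fin, nsmul_eq_mul, Nat.cast_ofNat]
          rw [hcard]
      _ = (2 * m + 1) ^ 2 * (4 * topGradConst) / m := by rw [hN]; push_cast; field_simp
      _ ≤ (3 * m) ^ 2 * (4 * topGradConst) / m := by gcongr; linarith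
      _ = 36 * topGradConst * m := by field_simp; ring
  -- the energy part, by Cauchy–Schwarz
  have hpartU : ∑ x ∈ latticeBall c m, ∑ k : Fin 4, |u (x + cornerUnit k) - u x| ≤ 78 * m := by
    have hsubB : latticeBall c m ⊆ B := latticeBall_subset (by omega)
    have hCS : (∑ x ∈ latticeBall c m, ∑ k : Fin 4, |u (x + cornerUnit k) - u x|) ^ 2 ≤
        ((2 * m + 1) ^ 2 * 4) * 160 := by
      -- `(∑_x ∑_k |g|)² ≤ (#terms) ∑_x ∑_k g²`
      have step : ∀ x ∈ latticeBall c m, (∑ k : Fin 4, |u (x + cornerUnit k) - u x|) ^ 2 ≤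
          4 * ∑ k : Fin 4, (u (x + cornerUnit k) - u x) ^ 2 := by
        intro x _
        have := Finset.sum_mul_sq_le_sq_mul_sq (Finset.univ : Finset (Fin 4))
          (fun k => |u (x + cornerUnit k) - u x|) (fun _ => (1 : ℝ))
        simp only [mul_one, one_pow, Finset.sum_const, Finset.card_univ, Fintype.card_fin, nsmul_eq_mul,
          Nat.cast_ofNat, sq_abs] at this
        linarith
      have outer := Finset.sum_mul_sq_le_sq_mul_sq (latticeBall c m)
        (fun x => ∑ k : Fin 4, |u (x + cornerUnit k) - u x|) (fun _ => (1 : ℝ))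
      simp only [mul_one, one_pow, Finset.sum_const, nsmul_eq_mul, hcard, mul_one] at outer
      calc (∑ x ∈ latticeBall c m, ∑ k : Fin 4, |u (x + cornerUnit k) - u x|) ^ 2
          ≤ (∑ x ∈ latticeBall c m, (∑ k : Fin 4, |u (x + cornerUnit k) - u x|) ^ 2) * (2 * m + 1) ^ 2 := outer
        _ ≤ (∑ x ∈ latticeBall c m, 4 * ∑ k : Fin 4, (u (x + cornerUnit k) - u x) ^ 2) * (2 * m + 1) ^ 2 := by
            gcongr with x hx; exact step x hx
        _ = (2 * m + 1) ^ 2 * 4 * ∑ x ∈ latticeBall c m, ∑ k : Fin 4, (u (x + cornerUnit k) - u x) ^ 2 := by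
            rw [← Finset.mul_sum]; ring
        _ ≤ (2 * m + 1) ^ 2 * 4 * ∑ x ∈ B, ∑ k : Fin 4, (u (x + cornerUnit k) - u x) ^ 2 := by
            refine mul_le_mul_of_nonneg_left ?_ (by positivity)
            exact Finset.sum_le_sum_of_subset_of_nonneg hsubB fun x _ _ => Finset.sum_nonneg fun k _ => sq_nonneg _
        _ ≤ (2 * m + 1) ^ 2 * 4 * 160 := by gcongr
    have hnonneg : 0 ≤ ∑ x ∈ latticeBall c m, ∑ k : Fin 4, |u (x + cornerUnit k) - u x| :=
      Finset.sum_nonneg fun x _ => Finset.sum_nonneg fun k _ => abs_nonneg _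
    -- `√(4 · 160) (2m+1) ≤ 26 (3m) = 78 m`
    have hsq : (∑ x ∈ latticeBall c m, ∑ k : Fin 4, |u (x + cornerUnit k) - u x|) ^ 2 ≤ (78 * m) ^ 2 := by
      refine hCS.trans ?_
      nlinarith
    exact (pow_le_pow_iff_left₀ hnonneg (by positivity) two_ne_zero).1 hsq
  calc ∑ x ∈ latticeBall c m, ∑ k : Fin 4, |s (x + cornerUnit k) - s x|
      ≤ ∑ x ∈ latticeBall c m, ∑ k : Fin 4, (|HH (x + cornerUnit k) - HH x| + |u (x + cornerUnit k) - u x|) :=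
        Finset.sum_le_sum fun x hx => Finset.sum_le_sum fun k _ => hsplit x hx k
    _ = (∑ x ∈ latticeBall c m, ∑ k : Fin 4, |HH (x + cornerUnit k) - HH x|) +
          ∑ x ∈ latticeBall c m, ∑ k : Fin 4, |u (x + cornerUnit k) - u x| := by
        rw [← Finset.sum_add_distrib]; exact Finset.sum_congr rfl fun x _ => Finset.sum_add_distrib
    _ ≤ 36 * topGradConst * m + 78 * m := add_le_add hpartHH hpartU
    _ = energyGradConst * m := by unfold energyGradConst; ring

end Sandwich

end Literature.Probability.LatticeModels
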